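import Literature.NumberTheory.LFunctions.DeuringHeilbronnTestFunction
import HarnessLib

/-!
# Bounds for the Laplace transforms of Heath-Brown's test functions

Topic `Literature/NumberTheory/LFunctions`, sub-namespaces `LaplaceShape` (general smooth shapes)
and `DHTest` (the specific shape `h = shape x₀ ε₂ ε₀` and test function `g = testFn x₀ ε₂ ε₀ L α`).
Everything here is PROVED (no definitions). With `H(W) = ∫₀^{x₀} h(t)e^{−Wt} dt`
(`LaplaceShape.shapeLaplace h x₀`), `F = fordLaplace g`, `F₀(z) = F(z) − g(0)/z`:

* `LaplaceShape.norm_shapeLaplace_sub_sum_le_weighted / _crude` — the remainder of the `k`-fold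
  expansion: `‖H(W) − Σ_{j<k} h^{(j)}(0)/W^{j+1}‖ ≤ M_k/(Re W · |W|^k)` (`Re W > 0`) and
  `≤ x₀ M_k e^{max(0,−Re W) x₀}/|W|^k`, `M_k = sup_{[0,x₀]} |h^{(k)}|`
  (Heath-Brown 1992, §7: the decay conditions on `F`);
* `DHTest.fordLaplace₀_testFn` — `F₀(z) = L·H(zL − α) − h(0)/z`;
* `DHTest.norm_fordLaplace₀_testFn_le_of_half_le_re` — on `Re z ≥ 1/2` (the left lines of the
  explicit formulae and the trivial zeros), for `0 ≤ α ≤ L/4`: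
  `‖F₀(z)‖ ≤ (2h(0)α/L + 4|h'(0)|/L + 16 M₂/L²)/‖z‖²` — no factor `e^{αx₀}`
  (this is what lets the positivity argument run with `e^{αx₀} ≈ λ₁⁻¹` large);
* `DHTest.norm_fordLaplace₀_testFn_le_of_re_pos` — on `Re z > 0` (the zero terms), the three-term
  bound `h(0)(α/L)/(|z||z − α/L|) + Σ_{1≤j<k} |h^{(j)}(0)|/(L^j |z − α/L|^{j+1})
  + x₀ M_k e^{αx₀}/(L^{k−1}|z − α/L|^k)`;
* `DHTest.re_shapeLaplace_shape_sub_le` — Heath-Brown's monotonicity step (proof of Lemma 8.1):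
  `Re{H(−λ₀ + iμ) − H(λ₁ − λ₀ + iμ)} ≤ H(−λ₀) − H(λ₁ − λ₀) ≤ λ₁ x₀ e^{λ₀x₀} H(0)`;
* `DHTest.shapeLaplace_shape_zero_ge` — `H(0) ≥ e^{−ε₀x₀}(x₀ − ε₂)²/2`, and `h(0) ≤ x₀`.

## References

* D. R. Heath-Brown, Proc. London Math. Soc. (3) 64 (1992), Lemma 5.1, §7, Lemma 8.1 (proof).
  [cite: HeathBrown1992PLMS, Lemma 5.1, Section 7, Lemma 8.1]
-/

noncomputable section

open Complex Real MeasureTheory Set intervalIntegral Filter Topology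

namespace Literature.NumberTheory.LFunctions

namespace LaplaceShape

/-- A continuous function is bounded on `[0, X]`: `∃ M ≥ 0, |φ^{(k)}| ≤ M` there. [folklore] -/
theorem exists_bound_iteratedDeriv {φ : ℝ → ℝ} (hφ : ∀ m : ℕ, ContDiff ℝ m φ) (X : ℝ) (k : ℕ) :
    ∃ M : ℝ, 0 ≤ M ∧ ∀ t ∈ Icc 0 X, |iteratedDeriv k φ t| ≤ M := by
  have hcont : Continuous (iteratedDeriv k φ) :=
    (hφ k).continuous_iteratedDeriv k (by exact_mod_cast le_rfl)
  obtain ⟨M, hM⟩ := isCompact_Icc.exists_bound_of_continuousOn (hcont.continuousOn (s := Icc 0 X))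
  refine ⟨max M 0, le_max_right _ _, fun t ht ↦ ?_⟩
  have := hM t ht
  rw [Real.norm_eq_abs] at this
  exact this.trans (le_max_left _ _)

/-- **Weighted remainder bound**: for a smooth `φ` vanishing on `[X, ∞)` (`X ≥ 0`),
`|φ^{(k)}| ≤ M` on `[0, X]`, and `Re W > 0`:
`‖H(W) − Σ_{j<k} φ^{(j)}(0)/W^{j+1}‖ ≤ M/(Re W · ‖W‖^k)`. [cite: HeathBrown1992PLMS, Section 7 (decay of F)] -/
theorem norm_shapeLaplace_sub_sum_le_weighted {φ : ℝ → ℝ} (hφ : ∀ m : ℕ, ContDiff ℝ m φ) {X : ℝ}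
    (hX : 0 ≤ X) (h0 : ∀ t, X ≤ t → φ t = 0) {k : ℕ} {M : ℝ}
    (hM : ∀ t ∈ Icc 0 X, |iteratedDeriv k φ t| ≤ M) {W : ℂ} (hW : 0 < W.re) :
    ‖shapeLaplace φ X W - ∑ j ∈ Finset.range k, ((iteratedDeriv j φ 0 : ℝ) : ℂ) / W ^ (j + 1)‖ ≤
      M / (W.re * ‖W‖ ^ k) := by
  have hW0 : W ≠ 0 := fun h ↦ by rw [h, Complex.zero_re] at hW; exact lt_irrefl _ hW
  have hM0 : 0 ≤ M := (abs_nonneg _).trans (hM 0 ⟨le_rfl, hX⟩)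
  rw [shapeLaplace_eq_sum_add hφ h0 hW0 k, add_sub_cancel_left, norm_mul, norm_inv, norm_pow]
  have hcont : Continuous (iteratedDeriv k φ) :=
    (hφ k).continuous_iteratedDeriv k (by exact_mod_cast le_rfl)
  have hb := norm_shapeLaplace_le (iteratedDeriv k φ) hX W
  -- `∫₀^X |φ^{(k)}| e^{−Re W t} ≤ M ∫₀^X e^{−Re W t} ≤ M / Re W`
  have hint : ∫ t in (0 : ℝ)..X, |iteratedDeriv k φ t| * Real.exp (-(W.re * t)) ≤ M / W.re := by
    have h1 : ∫ t in (0 : ℝ)..X, |iteratedDeriv k φ t| * Real.exp (-(W.re * t)) ≤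
        ∫ t in (0 : ℝ)..X, M * Real.exp (-(W.re * t)) := by
      refine intervalIntegral.integral_mono_on hX ?_ ?_ fun t ht ↦ ?_
      · exact ((continuous_abs.comp hcont).mul (by fun_prop)).intervalIntegrable _ _
      · exact (continuous_const.mul (by fun_prop)).intervalIntegrable _ _
      · exact mul_le_mul_of_nonneg_right (hM t ht) (Real.exp_nonneg _)
    have h2 : ∫ t in (0 : ℝ)..X, M * Real.exp (-(W.re * t)) = M * ((1 - Real.exp (-(W.re * X))) / W.re) := by
      rw [intervalIntegral.integral_const_mul]
      congr 1
      have hWne : W.re ≠ 0 := hW.ne'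
      have h3 := intervalIntegral.integral_comp_mul_left (a := (0 : ℝ)) (b := X) Real.exp (c := -W.re)
        (neg_ne_zero.2 hWne)
      simp only [neg_mul, mul_zero, integral_exp, Real.exp_zero, smul_eq_mul] at h3
      rw [h3]
      field_simp
      ring
    have h3 : M * ((1 - Real.exp (-(W.re * X))) / W.re) ≤ M / W.re := by
      rw [mul_div_assoc']
      refine div_le_div_of_nonneg_right ?_ hW.le
      nlinarith [Real.exp_nonneg (-(W.re * X))]
    linarith
  calc (‖W‖ ^ k)⁻¹ * ‖shapeLaplace (iteratedDeriv k φ) X W‖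
      ≤ (‖W‖ ^ k)⁻¹ * (M / W.re) := mul_le_mul_of_nonneg_left (hb.trans hint) (by positivity)
    _ = M / (W.re * ‖W‖ ^ k) := by
        field_simp

/-- **Crude remainder bound**: same hypotheses, any `W ≠ 0`:
`‖H(W) − Σ_{j<k} φ^{(j)}(0)/W^{j+1}‖ ≤ X M e^{max(0, −Re W) X}/‖W‖^k`. [cite: HeathBrown1992PLMS, Section 7 (decay of F)] -/
theorem norm_shapeLaplace_sub_sum_le_crude {φ : ℝ → ℝ} (hφ : ∀ m : ℕ, ContDiff ℝ m φ) {X : ℝ}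
    (hX : 0 ≤ X) (h0 : ∀ t, X ≤ t → φ t = 0) {k : ℕ} {M : ℝ}
    (hM : ∀ t ∈ Icc 0 X, |iteratedDeriv k φ t| ≤ M) {W : ℂ} (hW0 : W ≠ 0) :
    ‖shapeLaplace φ X W - ∑ j ∈ Finset.range k, ((iteratedDeriv j φ 0 : ℝ) : ℂ) / W ^ (j + 1)‖ ≤
      X * M * Real.exp (max 0 (-W.re) * X) / ‖W‖ ^ k := by
  have hM0 : 0 ≤ M := (abs_nonneg _).trans (hM 0 ⟨le_rfl, hX⟩)
  rw [shapeLaplace_eq_sum_add hφ h0 hW0 k, add_sub_cancel_left, norm_mul, norm_inv, norm_pow]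
  have hcont : Continuous (iteratedDeriv k φ) :=
    (hφ k).continuous_iteratedDeriv k (by exact_mod_cast le_rfl)
  have hb := norm_shapeLaplace_le_exp_mul hcont hX W
  have hint : ∫ t in (0 : ℝ)..X, |iteratedDeriv k φ t| ≤ X * M := by
    have h1 := intervalIntegral.integral_mono_on (μ := volume) hX
      ((continuous_abs.comp hcont).intervalIntegrable _ _)
      (continuous_const.intervalIntegrable _ _) (fun t ht ↦ hM t ht)
    simpa [mul_comm] using h1
  calc (‖W‖ ^ k)⁻¹ * ‖shapeLaplace (iteratedDeriv k φ) X W‖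
      ≤ (‖W‖ ^ k)⁻¹ * (Real.exp (max 0 (-W.re) * X) * (X * M)) :=
        mul_le_mul_of_nonneg_left (hb.trans (mul_le_mul_of_nonneg_left hint (Real.exp_nonneg _)))
          (by positivity)
    _ = X * M * Real.exp (max 0 (-W.re) * X) / ‖W‖ ^ k := by
        rw [inv_mul_eq_div]
        ring

/-- The case `k = 1` of the expansion: `H(W) − φ(0)/W`. [folklore] -/
theorem sum_range_one_eq (φ : ℝ → ℝ) (W : ℂ) :
    ∑ j ∈ Finset.range 1, ((iteratedDeriv j φ 0 : ℝ) : ℂ) / W ^ (j + 1) = (φ 0 : ℂ) / W := by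
  simp

/-- The case `k = 2`: `φ(0)/W + φ'(0)/W²`. [folklore] -/
theorem sum_range_two_eq (φ : ℝ → ℝ) (W : ℂ) :
    ∑ j ∈ Finset.range 2, ((iteratedDeriv j φ 0 : ℝ) : ℂ) / W ^ (j + 1) =
      (φ 0 : ℂ) / W + ((deriv φ 0 : ℝ) : ℂ) / W ^ 2 := by
  simp [Finset.sum_range_succ]

end LaplaceShape

namespace DHTest

open LaplaceShape

variable {x₀ ε₂ ε₀ L α : ℝ}

/-! ### `F₀` in terms of `H` -/

/-- `F₀(z) = L · H(zL − α) − h(0)/z`. [cite: HeathBrown1992PLMS, Lemma 5.1 (F₀ = F - f(0)/z)] -/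
theorem fordLaplace₀_testFn (hx₀ : 0 ≤ x₀) (hε : 0 < ε₂) (hL : 0 < L) (z : ℂ) :
    fordLaplace₀ (testFn x₀ ε₂ ε₀ L α) z =
      L * shapeLaplace (shape x₀ ε₂ ε₀) x₀ (z * L - α) - (shape x₀ ε₂ ε₀ 0 : ℂ) / z := by
  rw [fordLaplace₀, fordLaplace_testFn hx₀ hε hL, testFn_zero, shape_zero]

/-- The algebra of the leading terms: `L/(zL − α) − 1/z = (α/L)/(z (z − α/L))`, in norm:
`‖L · (c/W) − c/z‖ = |c| (α/L)/(‖z‖ ‖z − α/L‖)` for `W = zL − α`. [folklore] -/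
theorem norm_leading_diff {L α c : ℝ} (hL : 0 < L) {z : ℂ} (hz : z ≠ 0) (hzα : z - α / L ≠ 0)
    (hα : 0 ≤ α) :
    ‖(L : ℂ) * ((c : ℂ) / (z * L - α)) - (c : ℂ) / z‖ = |c| * (α / L) / (‖z‖ * ‖z - α / L‖) := by
  have hL' : (L : ℂ) ≠ 0 := by exact_mod_cast hL.ne'
  have hW : z * L - α ≠ 0 := by
    intro h
    apply hzα
    have : z - α / L = (z * L - α) / L := by field_simp
    rw [this, h, zero_div]
  have hW2 : (L : ℂ) * z - α ≠ 0 := by rwa [mul_comm] at hW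
  have key : (L : ℂ) * ((c : ℂ) / (z * L - α)) - (c : ℂ) / z = (c : ℂ) * (α / L) / (z * (z - α / L)) := by
    field_simp
    ring
  rw [key, norm_div, norm_mul, norm_mul, Complex.norm_real, Real.norm_eq_abs]
  congr 1
  rw [norm_div, Complex.norm_real, Complex.norm_real, Real.norm_eq_abs, Real.norm_eq_abs,
    abs_of_nonneg hα, abs_of_pos hL]

/-! ### The bound on `Re z ≥ 1/2` (left lines, trivial zeros): no `e^{αx₀}` -/

/-- **`F₀` on `Re z ≥ 1/2`**: for `0 ≤ α ≤ L/4`, `L > 0`, and `|h''| ≤ M₂` on `[0, x₀]`,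
`‖F₀(z)‖ ≤ (2 h(0) α/L + 4|h'(0)|/L + 16 M₂/L²)/‖z‖²`. [cite: HeathBrown1992PLMS, Lemma 5.1 (F₀(z) ≪ |z|⁻²)] -/
theorem norm_fordLaplace₀_testFn_le_of_half_le_re (hx₀ : 0 ≤ x₀) (hε : 0 < ε₂) (hL : 0 < L)
    (hα : 0 ≤ α) (hαL : α ≤ L / 4) {M₂ : ℝ}
    (hM : ∀ t ∈ Icc 0 x₀, |iteratedDeriv 2 (shape x₀ ε₂ ε₀) t| ≤ M₂) {z : ℂ} (hz : 1 / 2 ≤ z.re) :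
    ‖fordLaplace₀ (testFn x₀ ε₂ ε₀ L α) z‖ ≤
      (2 * shape x₀ ε₂ ε₀ 0 * (α / L) + 4 * |deriv (shape x₀ ε₂ ε₀) 0| / L + 16 * M₂ / L ^ 2) / ‖z‖ ^ 2 := by
  set h := shape x₀ ε₂ ε₀ with hh
  set W : ℂ := z * L - α with hW
  have hzn : 1 / 2 ≤ ‖z‖ := hz.trans (Complex.re_le_norm z)
  have hz0 : z ≠ 0 := norm_pos_iff.1 (by linarith)
  have hαL' : α / L ≤ 1 / 4 := by rw [div_le_iff₀ hL]; linarith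
  -- `‖z − α/L‖ ≥ ‖z‖/2`
  have hzα_re : 1 / 4 ≤ (z - α / L).re := by
    simp only [sub_re, div_ofReal_re, ofReal_re]  -- `(α/L : ℂ).re = α/L`
    have : ((α : ℂ) / L).re = α / L := by rw [← Complex.ofReal_div]; exact Complex.ofReal_re _
    linarith
  have hzα_norm : ‖z‖ / 2 ≤ ‖z - α / L‖ := by
    have h1 : ‖z‖ ≤ ‖z - α / L‖ + ‖(α : ℂ) / L‖ := by
      have := norm_add_le (z - α / L) ((α : ℂ) / L)
      rwa [sub_add_cancel] at this
    have h2 : ‖(α : ℂ) / L‖ = α / L := by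
      rw [← Complex.ofReal_div, Complex.norm_real, Real.norm_eq_abs, abs_of_nonneg (div_nonneg hα hL.le)]
    have h3 : (1 : ℝ) / 4 ≤ ‖z - α / L‖ := hzα_re.trans (Complex.re_le_norm _)
    rw [h2] at h1
    linarith
  have hzα0 : z - α / L ≠ 0 := norm_pos_iff.1 (by linarith)
  -- `W = L (z − α/L)`, `Re W ≥ L/4`, `‖W‖ = L ‖z − α/L‖`
  have hL' : (L : ℂ) ≠ 0 := by exact_mod_cast hL.ne'
  have hWeq : W = L * (z - α / L) := by rw [hW]; field_simp
  have hWre : L / 4 ≤ W.re := by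
    rw [hWeq, Complex.re_ofReal_mul]
    nlinarith
  have hWre0 : 0 < W.re := lt_of_lt_of_le (by positivity) hWre
  have hWnorm : ‖W‖ = L * ‖z - α / L‖ := by
    rw [hWeq, norm_mul, Complex.norm_real, Real.norm_eq_abs, abs_of_pos hL]
  -- expand `H(W)` to order 2
  have hexp := norm_shapeLaplace_sub_sum_le_weighted (shape_contDiff x₀ ε₂ ε₀) hx₀
    (fun t ht ↦ shape_eq_zero hε ht) hM hWre0
  rw [sum_range_two_eq] at hexp
  have hM0 : 0 ≤ M₂ := (abs_nonneg _).trans (hM 0 ⟨le_rfl, hx₀⟩)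
  -- `F₀(z) = [L h₀/W − h₀/z] + L h₁/W² + L R₂`
  rw [fordLaplace₀_testFn hx₀ hε hL]
  set R₂ := shapeLaplace h x₀ W - ((h 0 : ℂ) / W + ((deriv h 0 : ℝ) : ℂ) / W ^ 2) with hR₂
  have hdecomp : (L : ℂ) * shapeLaplace h x₀ W - (h 0 : ℂ) / z =
      ((L : ℂ) * ((h 0 : ℂ) / (z * L - α)) - (h 0 : ℂ) / z) + (L : ℂ) * (((deriv h 0 : ℝ) : ℂ) / W ^ 2) +
        (L : ℂ) * R₂ := by
    rw [hR₂, hW]; ring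
  rw [hdecomp]
  have h0nn : 0 ≤ h 0 := by rw [hh]; exact shape_nonneg hε 0
  -- the three pieces
  have t1 : ‖(L : ℂ) * ((h 0 : ℂ) / (z * L - α)) - (h 0 : ℂ) / z‖ ≤ 2 * h 0 * (α / L) / ‖z‖ ^ 2 := by
    rw [norm_leading_diff hL hz0 hzα0 hα, abs_of_nonneg h0nn]
    rw [div_le_div_iff₀ (by positivity) (by positivity)]
    have : ‖z‖ ^ 2 ≤ 2 * (‖z‖ * ‖z - α / L‖) := by nlinarith [norm_nonneg z]
    calc h 0 * (α / L) * ‖z‖ ^ 2 ≤ h 0 * (α / L) * (2 * (‖z‖ * ‖z - α / L‖)) :=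
          mul_le_mul_of_nonneg_left this (by positivity)
      _ = 2 * h 0 * (α / L) * (‖z‖ * ‖z - α / L‖) := by ring
  have t2 : ‖(L : ℂ) * (((deriv h 0 : ℝ) : ℂ) / W ^ 2)‖ ≤ 4 * |deriv h 0| / L / ‖z‖ ^ 2 := by
    rw [norm_mul, Complex.norm_real, Real.norm_eq_abs, abs_of_pos hL, norm_div, Complex.norm_real,
      Real.norm_eq_abs, norm_pow, hWnorm]
    have hzpos : 0 < ‖z‖ := by linarith
    have hN : ‖z‖ ^ 2 / 4 ≤ ‖z - α / L‖ ^ 2 := by nlinarith [hzα_norm, norm_nonneg z]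
    have hNpos : 0 < ‖z - α / L‖ := by linarith
    calc L * (|deriv h 0| / (L * ‖z - α / L‖) ^ 2) = |deriv h 0| / (L * ‖z - α / L‖ ^ 2) := by
          field_simp
      _ ≤ |deriv h 0| / (L * (‖z‖ ^ 2 / 4)) :=
          div_le_div_of_nonneg_left (abs_nonneg _) (by positivity) (mul_le_mul_of_nonneg_left hN hL.le)
      _ = 4 * |deriv h 0| / L / ‖z‖ ^ 2 := by
          field_simp
  have t3 : ‖(L : ℂ) * R₂‖ ≤ 16 * M₂ / L ^ 2 / ‖z‖ ^ 2 := by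
    rw [norm_mul, Complex.norm_real, Real.norm_eq_abs, abs_of_pos hL]
    have hR : ‖R₂‖ ≤ M₂ / (W.re * ‖W‖ ^ 2) := hexp
    have hR' : M₂ / (W.re * ‖W‖ ^ 2) ≤ M₂ / ((L / 4) * (L * (‖z‖ / 2)) ^ 2) := by
      refine div_le_div_of_nonneg_left hM0 (by positivity) ?_
      rw [hWnorm]
      have : (L * (‖z‖ / 2)) ^ 2 ≤ (L * ‖z - α / L‖) ^ 2 :=
        pow_le_pow_left₀ (by positivity) (mul_le_mul_of_nonneg_left hzα_norm hL.le) 2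
      exact mul_le_mul hWre this (by positivity) hWre0.le
    calc L * ‖R₂‖ ≤ L * (M₂ / ((L / 4) * (L * (‖z‖ / 2)) ^ 2)) :=
          mul_le_mul_of_nonneg_left (hR.trans hR') hL.le
      _ = 16 * M₂ / L ^ 2 / ‖z‖ ^ 2 := by field_simp; ring
  calc ‖(L : ℂ) * ((h 0 : ℂ) / (z * L - α)) - (h 0 : ℂ) / z + (L : ℂ) * (((deriv h 0 : ℝ) : ℂ) / W ^ 2) + (L : ℂ) * R₂‖
      ≤ ‖(L : ℂ) * ((h 0 : ℂ) / (z * L - α)) - (h 0 : ℂ) / z‖ + ‖(L : ℂ) * (((deriv h 0 : ℝ) : ℂ) / W ^ 2)‖ +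
          ‖(L : ℂ) * R₂‖ := norm_add₃_le
    _ ≤ 2 * h 0 * (α / L) / ‖z‖ ^ 2 + 4 * |deriv h 0| / L / ‖z‖ ^ 2 + 16 * M₂ / L ^ 2 / ‖z‖ ^ 2 := by
        linarith
    _ = (2 * h 0 * (α / L) + 4 * |deriv h 0| / L + 16 * M₂ / L ^ 2) / ‖z‖ ^ 2 := by ring

/-! ### The bound on `Re z > 0` (zero terms) -/

/-- **`F₀` at the zero terms**: for `W = zL − α` with `Re z > 0` (so `Re W ≥ −α`), `z ≠ α/L`,
`0 ≤ α`, `L > 0`, `k ≥ 1` and `|h^{(k)}| ≤ M_k` on `[0, x₀]`: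
`‖F₀(z)‖ ≤ h(0)(α/L)/(‖z‖‖z − α/L‖) + Σ_{1≤j<k} |h^{(j)}(0)|/(L^j ‖z − α/L‖^{j+1})
  + x₀ M_k e^{αx₀}/(L^{k−1} ‖z − α/L‖^k)`. [cite: HeathBrown1992PLMS, Lemma 5.1 and Section 7 (decay of F at the zeros)] -/
theorem norm_fordLaplace₀_testFn_le_of_re_pos (hx₀ : 0 ≤ x₀) (hε : 0 < ε₂) (hL : 0 < L)
    (hα : 0 ≤ α) {k : ℕ} (hk : 1 ≤ k) {Mk : ℝ}
    (hM : ∀ t ∈ Icc 0 x₀, |iteratedDeriv k (shape x₀ ε₂ ε₀) t| ≤ Mk) {z : ℂ} (hz : 0 < z.re)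
    (hzα : z - α / L ≠ 0) :
    ‖fordLaplace₀ (testFn x₀ ε₂ ε₀ L α) z‖ ≤
      shape x₀ ε₂ ε₀ 0 * (α / L) / (‖z‖ * ‖z - α / L‖) +
        ∑ j ∈ Finset.Ico 1 k, |iteratedDeriv j (shape x₀ ε₂ ε₀) 0| / (L ^ j * ‖z - α / L‖ ^ (j + 1)) +
        x₀ * Mk * Real.exp (α * x₀) / (L ^ (k - 1) * ‖z - α / L‖ ^ k) := by
  obtain ⟨k', rfl⟩ : ∃ k', k = k' + 1 := ⟨k - 1, by omega⟩
  simp only [Nat.add_sub_cancel]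
  set h := shape x₀ ε₂ ε₀ with hh
  set W : ℂ := z * L - α with hW
  have hz0 : z ≠ 0 := fun h0 ↦ by rw [h0, Complex.zero_re] at hz; exact lt_irrefl _ hz
  have hL' : (L : ℂ) ≠ 0 := by exact_mod_cast hL.ne'
  have hWeq : W = L * (z - α / L) := by rw [hW]; field_simp
  have hW0 : W ≠ 0 := by rw [hWeq]; exact mul_ne_zero hL' hzα
  have hWnorm : ‖W‖ = L * ‖z - α / L‖ := by
    rw [hWeq, norm_mul, Complex.norm_real, Real.norm_eq_abs, abs_of_pos hL]
  have hWre : -α ≤ W.re := by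
    have : W.re = z.re * L - α := by rw [hW, sub_re, Complex.re_mul_ofReal, Complex.ofReal_re]
    rw [this]
    nlinarith
  have hmax : max 0 (-W.re) ≤ α := max_le hα (by linarith)
  -- expand `H(W)` to order `k`
  have hexp := norm_shapeLaplace_sub_sum_le_crude (shape_contDiff x₀ ε₂ ε₀) hx₀
    (fun t ht ↦ shape_eq_zero hε ht) hM hW0
  have hMk0 : 0 ≤ Mk := (abs_nonneg _).trans (hM 0 ⟨le_rfl, hx₀⟩)
  set Rk := shapeLaplace h x₀ W - ∑ j ∈ Finset.range (k' + 1), ((iteratedDeriv j h 0 : ℝ) : ℂ) / W ^ (j + 1)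
    with hRk
  have hsplit : ∑ j ∈ Finset.range (k' + 1), ((iteratedDeriv j h 0 : ℝ) : ℂ) / W ^ (j + 1) =
      (h 0 : ℂ) / W + ∑ j ∈ Finset.Ico 1 (k' + 1), ((iteratedDeriv j h 0 : ℝ) : ℂ) / W ^ (j + 1) := by
    rw [Finset.range_eq_Ico, Finset.sum_eq_sum_Ico_succ_bot (Nat.succ_pos k')]
    simp
  rw [fordLaplace₀_testFn hx₀ hε hL]
  have hdecomp : (L : ℂ) * shapeLaplace h x₀ W - (h 0 : ℂ) / z =
      ((L : ℂ) * ((h 0 : ℂ) / (z * L - α)) - (h 0 : ℂ) / z) +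
        (L : ℂ) * ∑ j ∈ Finset.Ico 1 (k' + 1), ((iteratedDeriv j h 0 : ℝ) : ℂ) / W ^ (j + 1) + (L : ℂ) * Rk := by
    have : shapeLaplace h x₀ W = (h 0 : ℂ) / W +
        ∑ j ∈ Finset.Ico 1 (k' + 1), ((iteratedDeriv j h 0 : ℝ) : ℂ) / W ^ (j + 1) + Rk := by
      rw [hRk, hsplit]; ring
    rw [this, hW]; ring
  rw [hdecomp]
  have h0nn : 0 ≤ h 0 := by rw [hh]; exact shape_nonneg hε 0
  have t1 : ‖(L : ℂ) * ((h 0 : ℂ) / (z * L - α)) - (h 0 : ℂ) / z‖ = h 0 * (α / L) / (‖z‖ * ‖z - α / L‖) := by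
    rw [norm_leading_diff hL hz0 hzα hα, abs_of_nonneg h0nn]
  have t2 : ‖(L : ℂ) * ∑ j ∈ Finset.Ico 1 (k' + 1), ((iteratedDeriv j h 0 : ℝ) : ℂ) / W ^ (j + 1)‖ ≤
      ∑ j ∈ Finset.Ico 1 (k' + 1), |iteratedDeriv j h 0| / (L ^ j * ‖z - α / L‖ ^ (j + 1)) := by
    rw [Finset.mul_sum]
    refine (norm_sum_le _ _).trans (le_of_eq (Finset.sum_congr rfl fun j hj ↦ ?_))
    rw [norm_mul, Complex.norm_real, Real.norm_eq_abs, abs_of_pos hL, norm_div, Complex.norm_real,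
      Real.norm_eq_abs, norm_pow, hWnorm, mul_pow]
    have hj1 : 1 ≤ j := (Finset.mem_Ico.1 hj).1
    field_simp
    rw [show L ^ (j + 1) = L ^ j * L by ring]
    ring
  have t3 : ‖(L : ℂ) * Rk‖ ≤ x₀ * Mk * Real.exp (α * x₀) / (L ^ k' * ‖z - α / L‖ ^ (k' + 1)) := by
    rw [norm_mul, Complex.norm_real, Real.norm_eq_abs, abs_of_pos hL]
    have hR : ‖Rk‖ ≤ x₀ * Mk * Real.exp (max 0 (-W.re) * x₀) / ‖W‖ ^ (k' + 1) := hexp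
    have hR' : x₀ * Mk * Real.exp (max 0 (-W.re) * x₀) / ‖W‖ ^ (k' + 1) ≤
        x₀ * Mk * Real.exp (α * x₀) / ‖W‖ ^ (k' + 1) := by
      refine div_le_div_of_nonneg_right ?_ (by positivity)
      exact mul_le_mul_of_nonneg_left (Real.exp_le_exp.2 (mul_le_mul_of_nonneg_right hmax hx₀))
        (by positivity)
    have hzα' : ‖z - α / L‖ ≠ 0 := norm_ne_zero_iff.2 hzα
    calc L * ‖Rk‖ ≤ L * (x₀ * Mk * Real.exp (α * x₀) / ‖W‖ ^ (k' + 1)) :=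
          mul_le_mul_of_nonneg_left (hR.trans hR') hL.le
      _ = x₀ * Mk * Real.exp (α * x₀) / (L ^ k' * ‖z - α / L‖ ^ (k' + 1)) := by
          rw [hWnorm, mul_pow, pow_succ L k']
          field_simp
  calc ‖(L : ℂ) * ((h 0 : ℂ) / (z * L - α)) - (h 0 : ℂ) / z +
        (L : ℂ) * ∑ j ∈ Finset.Ico 1 (k' + 1), ((iteratedDeriv j h 0 : ℝ) : ℂ) / W ^ (j + 1) + (L : ℂ) * Rk‖
      ≤ ‖(L : ℂ) * ((h 0 : ℂ) / (z * L - α)) - (h 0 : ℂ) / z‖ +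
          ‖(L : ℂ) * ∑ j ∈ Finset.Ico 1 (k' + 1), ((iteratedDeriv j h 0 : ℝ) : ℂ) / W ^ (j + 1)‖ +
          ‖(L : ℂ) * Rk‖ := norm_add₃_le
    _ ≤ _ := by rw [t1]; linarith

/-! ### The real axis and the monotonicity step -/

/-- `H` at a real point is real: `H(σ) = ∫₀^{x₀} h(t) e^{−σt} dt`. [folklore] -/
theorem shapeLaplace_ofReal (φ : ℝ → ℝ) (X σ : ℝ) :
    shapeLaplace φ X (σ : ℂ) = ((∫ t in (0 : ℝ)..X, φ t * Real.exp (-(σ * t)) : ℝ) : ℂ) := by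
  rw [shapeLaplace, ← intervalIntegral.integral_ofReal]
  refine intervalIntegral.integral_congr fun t _ ↦ ?_
  push_cast
  ring

/-- **The monotonicity step** (Heath-Brown 1992, proof of Lemma 8.1: "the expression … is
`≤ F(−λ₂) − F(λ₁ − λ₂)` … `≤ λ₁ ∫ t f(t) e^{λ₂t} dt`"): for `0 ≤ λ₁`, `0 ≤ λ₀`, real `μ` and a
non-negative shape `h` vanishing on `[x₀, ∞)` (`x₀ ≥ 0`),
`Re{H(−λ₀ + iμ) − H(λ₁ − λ₀ + iμ)} ≤ λ₁ x₀ e^{λ₀ x₀} · Re H(0)`. [cite: HeathBrown1992PLMS, Lemma 8.1 (proof)] -/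
theorem re_shapeLaplace_sub_le {φ : ℝ → ℝ} (hφc : Continuous φ) (hφ0 : ∀ t, 0 ≤ φ t) {X : ℝ}
    (hX : 0 ≤ X) {lam₁ lam₀ : ℝ} (h1 : 0 ≤ lam₁) (h0 : 0 ≤ lam₀) (μ : ℝ) :
    (shapeLaplace φ X ((-lam₀ : ℝ) + μ * I) - shapeLaplace φ X ((lam₁ - lam₀ : ℝ) + μ * I)).re ≤
      lam₁ * X * Real.exp (lam₀ * X) * (shapeLaplace φ X 0).re := by
  rw [Complex.sub_re, re_shapeLaplace_eq φ hφc, re_shapeLaplace_eq φ hφc,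
    show (0 : ℂ) = ((0 : ℝ) : ℂ) + (0 : ℝ) * I by simp, re_shapeLaplace_eq φ hφc]
  simp only [zero_mul, neg_zero, Real.exp_zero, mul_one, Real.cos_zero]
  have hi1 : IntervalIntegrable (fun t ↦ φ t * Real.exp (-(-lam₀ * t)) * Real.cos (μ * t)) volume 0 X :=
    ((hφc.mul (by fun_prop)).mul (by fun_prop)).intervalIntegrable _ _
  have hi2 : IntervalIntegrable (fun t ↦ φ t * Real.exp (-((lam₁ - lam₀) * t)) * Real.cos (μ * t)) volume 0 X :=
    ((hφc.mul (by fun_prop)).mul (by fun_prop)).intervalIntegrable _ _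
  rw [← intervalIntegral.integral_sub hi1 hi2, ← intervalIntegral.integral_const_mul]
  refine intervalIntegral.integral_mono_on hX (hi1.sub hi2) ((continuous_const.mul hφc).intervalIntegrable _ _)
    fun t ht ↦ ?_
  -- pointwise: `φ e^{λ₀t}(1 − e^{−λ₁t}) cos(μt) ≤ φ e^{λ₀t}(1 − e^{−λ₁ t}) ≤ λ₁ t e^{λ₀ t} φ ≤ λ₁ X e^{λ₀X} φ`
  have hφt := hφ0 t
  have he : Real.exp (-((lam₁ - lam₀) * t)) = Real.exp (-(-lam₀ * t)) * Real.exp (-(lam₁ * t)) := by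
    rw [← Real.exp_add]; ring_nf
  rw [he]
  have hA : 0 ≤ φ t * Real.exp (-(-lam₀ * t)) * (1 - Real.exp (-(lam₁ * t))) := by
    refine mul_nonneg (mul_nonneg hφt (Real.exp_nonneg _)) ?_
    have : Real.exp (-(lam₁ * t)) ≤ 1 := Real.exp_le_one_iff.2 (by nlinarith [ht.1])
    linarith
  have hcos := Real.cos_le_one (μ * t)
  have h1e : 1 - Real.exp (-(lam₁ * t)) ≤ lam₁ * t := by
    have := Real.add_one_le_exp (-(lam₁ * t)); linarith
  have hexpX : Real.exp (-(-lam₀ * t)) ≤ Real.exp (lam₀ * X) := Real.exp_le_exp.2 (by nlinarith [ht.2])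
  calc φ t * Real.exp (-(-lam₀ * t)) * Real.cos (μ * t) -
        φ t * (Real.exp (-(-lam₀ * t)) * Real.exp (-(lam₁ * t))) * Real.cos (μ * t)
      = (φ t * Real.exp (-(-lam₀ * t)) * (1 - Real.exp (-(lam₁ * t)))) * Real.cos (μ * t) := by ring
    _ ≤ φ t * Real.exp (-(-lam₀ * t)) * (1 - Real.exp (-(lam₁ * t))) :=
        mul_le_of_le_one_right hA hcos
    _ ≤ φ t * Real.exp (lam₀ * X) * (lam₁ * X) := by
        have h2 : 1 - Real.exp (-(lam₁ * t)) ≤ lam₁ * X := h1e.trans (by nlinarith [ht.2])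
        have h3 : 0 ≤ 1 - Real.exp (-(lam₁ * t)) := by
          have : Real.exp (-(lam₁ * t)) ≤ 1 := Real.exp_le_one_iff.2 (by nlinarith [ht.1]); linarith
        calc φ t * Real.exp (-(-lam₀ * t)) * (1 - Real.exp (-(lam₁ * t)))
            ≤ φ t * Real.exp (lam₀ * X) * (1 - Real.exp (-(lam₁ * t))) :=
              mul_le_mul_of_nonneg_right (mul_le_mul_of_nonneg_left hexpX hφt) h3
          _ ≤ φ t * Real.exp (lam₀ * X) * (lam₁ * X) :=
              mul_le_mul_of_nonneg_left h2 (by positivity)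
    _ = lam₁ * X * Real.exp (lam₀ * X) * φ t := by ring

/-- **`H(0)` is large**: `Re H(0) = ∫₀^{x₀} h ≥ e^{−ε₀x₀}(x₀ − ε₂)²/2` for the shape `h`
(`0 < ε₂ ≤ x₀`, `0 ≤ ε₀`). [cite: HeathBrown1992PLMS, Lemma 8.1 (F(0) for f(t) = x₀ - t)] -/
theorem shapeLaplace_shape_zero_ge (hε : 0 < ε₂) (hεx : ε₂ ≤ x₀) (hε₀ : 0 ≤ ε₀) :
    Real.exp (-(ε₀ * x₀)) * ((x₀ - ε₂) ^ 2 / 2) ≤ (shapeLaplace (shape x₀ ε₂ ε₀) x₀ 0).re := by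
  have hx₀ : 0 ≤ x₀ := hε.le.trans hεx
  rw [show (0 : ℂ) = ((0 : ℝ) : ℂ) + (0 : ℝ) * I by simp, re_shapeLaplace_eq _ (shape_continuous x₀ ε₂ ε₀)]
  simp only [zero_mul, neg_zero, Real.exp_zero, mul_one, Real.cos_zero]
  -- `shape t ≥ e^{−ε₀x₀} tri t ≥ e^{−ε₀x₀} (x₀ − ε₂ − t)₊`
  have hlow : ∀ t ∈ Icc 0 x₀, Real.exp (-(ε₀ * x₀)) * max (x₀ - ε₂ - t) 0 ≤ shape x₀ ε₂ ε₀ t := by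
    intro t ht
    rw [shape]
    have h1 : Real.exp (-(ε₀ * x₀)) ≤ Real.exp (-(ε₀ * t)) := Real.exp_le_exp.2 (by nlinarith [ht.2])
    have h2 : max (x₀ - ε₂ - t) 0 ≤ tri x₀ ε₂ t := by
      rcases le_or_gt t (x₀ - ε₂) with h | h
      · rw [max_eq_left (by linarith)]; exact tri_ge hε h
      · rw [max_eq_right (by linarith)]; exact tri_nonneg hε t
    calc Real.exp (-(ε₀ * x₀)) * max (x₀ - ε₂ - t) 0 ≤ Real.exp (-(ε₀ * t)) * tri x₀ ε₂ t :=
          mul_le_mul h1 h2 (le_max_right _ _) (Real.exp_nonneg _)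
      _ = tri x₀ ε₂ t * Real.exp (-(ε₀ * t)) := mul_comm _ _
  have hcmax : Continuous fun t : ℝ ↦ max (x₀ - ε₂ - t) 0 :=
    (continuous_const.sub continuous_id).max continuous_const
  have hint := intervalIntegral.integral_mono_on (μ := volume) hx₀
    ((show Continuous (fun t : ℝ ↦ Real.exp (-(ε₀ * x₀)) * max (x₀ - ε₂ - t) 0) from
      continuous_const.mul hcmax).intervalIntegrable _ _)
    ((shape_continuous x₀ ε₂ ε₀).intervalIntegrable _ _) hlow
  refine le_trans ?_ hint
  rw [intervalIntegral.integral_const_mul]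
  refine mul_le_mul_of_nonneg_left ?_ (Real.exp_nonneg _)
  -- `∫₀^{x₀} (x₀ − ε₂ − t)₊ dt ≥ ∫₀^{x₀−ε₂} (x₀ − ε₂ − t) dt = (x₀ − ε₂)²/2`
  have hsplit : ∫ t in (0 : ℝ)..x₀, max (x₀ - ε₂ - t) 0 =
      (∫ t in (0 : ℝ)..(x₀ - ε₂), max (x₀ - ε₂ - t) 0) + ∫ t in (x₀ - ε₂)..x₀, max (x₀ - ε₂ - t) 0 := by
    rw [intervalIntegral.integral_add_adjacent_intervals] <;> exact hcmax.intervalIntegrable _ _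
  have h1 : ∫ t in (0 : ℝ)..(x₀ - ε₂), max (x₀ - ε₂ - t) 0 = (x₀ - ε₂) ^ 2 / 2 := by
    rw [intervalIntegral.integral_congr (g := fun t ↦ (x₀ - ε₂) - t) fun t ht ↦ by
      rw [uIcc_of_le (by linarith)] at ht
      exact max_eq_left (by linarith [ht.2])]
    simp only [intervalIntegral.integral_sub (continuous_const.intervalIntegrable _ _)
      ((continuous_id (X := ℝ)).intervalIntegrable _ _) |> fun h => (show (∫ x : ℝ in (0 : ℝ)..(x₀ - ε₂),
        (x₀ - ε₂) - x) = (∫ _ : ℝ in (0 : ℝ)..(x₀ - ε₂), (x₀ - ε₂)) - ∫ x : ℝ in (0 : ℝ)..(x₀ - ε₂), x from h)]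
    simp [integral_id]
    ring
  have h2 : 0 ≤ ∫ t in (x₀ - ε₂)..x₀, max (x₀ - ε₂ - t) 0 :=
    intervalIntegral.integral_nonneg (by linarith) fun t _ ↦ le_max_right _ _
  linarith

/-- `h(0) ≤ x₀` (`0 < ε₂ ≤ x₀`). [folklore] -/
theorem shape_zero_le (hε : 0 < ε₂) (hεx : ε₂ ≤ x₀) : shape x₀ ε₂ ε₀ 0 ≤ x₀ := by
  rw [shape_zero]; exact (tri_zero_mem hε hεx).2

/-- `h(0) ≥ x₀ − ε₂`. [folklore] -/
theorem shape_zero_ge (hε : 0 < ε₂) (hεx : ε₂ ≤ x₀) : x₀ - ε₂ ≤ shape x₀ ε₂ ε₀ 0 := by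
  rw [shape_zero]; exact (tri_zero_mem hε hεx).1

end DHTest

end Literature.NumberTheory.LFunctions

end
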